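import Summits.QuantumFields.BalabanUV.T4Continuum.Support.DirichletTubeBounds

/-!
# `BalabanUV.T4Continuum.Support.DirichletTubeHoleFilling` — NE2 (node U1a) formalisation swarm, sub-row `T4-U1a.S-NE2-D1-DIRICHLET°`, supplier
# item «Δ1-HOLEFILL» (tube decay, part 3): WIDMAN'S HOLE-FILLING STEP ON A TUBE — hole-filling in the `d ≥ 2` transversal directions, slice by
# slice along one longitudinal direction `μ₀`, against a FIXED longitudinal profile `φ` whose ramps enter as a geometric source
# (unit b2b-balaban-t4-ne2-formalise-leaf-08, gen 6, file 13)

HONEST FRAMING.  Rung (B)+1 bookkeeping at MODEL level (one lattice field, finite torus); [folklore] lattice De Giorgi–Widman; NE2 (U1a) is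
NOT proved by this file; spine PROVED 0/9 unchanged; NOT infinite volume, NOT the mass gap, NOT Clay.  HONEST DEPENDENCY (verbatim):
«continuum YM on T⁴ ⇐ BetaPertH ∧ nine spine estimates (0/9 proved); BetaPertH ⇐ (D1) ∧ (D4) ∧ CAP+tail; G-an2-4 gates asym, D1 and NE2/3/4.»

WHAT THIS FILE PROVES (0 sorry).  Torus `Tor N`, `N : Fin (d+1) → ℕ`, longitudinal direction `μ₀`, transversal chart `chart N′ b′` (`4k = n+1 ≤ N′ ν`),
longitudinal profile `0 ≤ φ` with `|φ(t+1) − φ t| ≤ ℓ` (no upper bound on `φ` is needed: the weights `φ²` sit on both sides), a longitudinal ZONE `S` containing every `t` with `φ t ≠ 0` and both ends of every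
bond where `φ` changes; `z` supported in `Ω`, and every slice `zsl t`, `t ∈ S`, vanishing on the transversal chart octant `oct σ k`.  With the
WEIGHTED transversal energies `E_in = Σ_t φ(t)²·dirOn (inner k)(zsl t ∘ chart b′)`, `E_out = Σ_t φ(t)²·dirOn univ (zsl t ∘ chart b′)`, the weighted
source `M = Σ_t φ(t)²·Σ_j ‖(1_ΩΔz)(ins t (chart b′ j))‖²` and the zone energy `U = Σ_{t ∈ S} dirOn univ (zsl t ∘ chart b′)`:
**`tube_step`**: `E_in ≤ θ_d·E_out + 16(1+2^d)k²·(M/‖c‖⁴ + 4ℓ²·U)` — `DirichletCaccioppoli.caccioppoli_region` BY NAME with the tube cutoff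
`etaT` of `DirichletTubeBounds`, whose (L)/(E)/(S) budgets are slice-wise; the transversal transition mass is paid per slice by
`CoordAnnulusPoincare.annulus_mass_le` + `slabs_dir_le` exactly as in `DirichletHoleFilling.hole_filling_step`; the longitudinal transition mass by
`CoordOctantBoxes.sum_norm_sq_cube_le` per slice (`P ≤ 8k²`), a term `ℓ²k²·U` which along the dyadic transversal scales `k = K·2^{−i}` is a
GEOMETRIC SOURCE (file 14 iterates).

ABSOLUTE RULE (cell, verbatim): «No internally-minted statement may enter as a cited fact. Every hypothesis is either kernel-proved in
this package or a verbatim quotation of a PUBLISHED theorem with page reference. The manuscript(s) under audit are NOT citable for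
their own disputed steps — they are the thing under adjudication; programme-internal (2001/route/tribunal) claims are never citable.»
[folklore]; no definitions; no `def … : Prop` fact.  NOT CLAIMED: anything at the residue; NE2; NE3.
-/

noncomputable section

open scoped BigOperators ComplexConjugate Matrix
open Finset

namespace Summit.QuantumFields.BalabanUV.T4Continuum.DirichletTubeHoleFilling

open Literature.MathematicalPhysics.QuantumFieldTheory.Balaban1983to89.B5Prop11Plancherel (Tor unitVec)
open Literature.MathematicalPhysics.QuantumFieldTheory.Balaban1983to89.B5Action121 (sdiff LapS)
open Literature.MathematicalPhysics.QuantumFieldTheory.Balaban1983to89.Beta.CoordCubePoincare (stepUp)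
open Summit.QuantumFields.BalabanUV.T4Continuum.DirichletDirectionalBesov (restrictTo)
open Summit.QuantumFields.BalabanUV.T4Continuum.DirichletDirectionalBesovCutoff (cut)
open Summit.QuantumFields.BalabanUV.T4Continuum.DirichletCaccioppoli (caccioppoli_region)
open Summit.QuantumFields.BalabanUV.T4Continuum.CoordSlabPoincare (dirOn dirOn_nonneg lo)
open Summit.QuantumFields.BalabanUV.T4Continuum.CoordSlabPoincareHi (hi)
open Summit.QuantumFields.BalabanUV.T4Continuum.CoordOctantBoxes (oct sum_norm_sq_cube_le)
open Summit.QuantumFields.BalabanUV.T4Continuum.CoordAnnulusPoincare (inner slabDir slabDir_nonneg annConst annulus_mass_le slabs_dir_le)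
open Summit.QuantumFields.BalabanUV.T4Continuum.DirichletHoleFillingCutoff (chart)
open Summit.QuantumFields.BalabanUV.T4Continuum.DirichletHoleFilling (Kd theta Kd_nonneg theta_lt_one sqrt_mul_sqrt_le)
open Summit.QuantumFields.BalabanUV.T4Continuum.TorusSlicing (Nsl ins zsl)
open Summit.QuantumFields.BalabanUV.T4Continuum.DirichletTubeBounds (etaT etaT_nonneg lower_bound_tube error_bound_tube source_bound_tube)

variable {d : ℕ} (N : Fin (d + 1) → ℕ) [hN : ∀ μ, NeZero (N μ)] (μ₀ : Fin (d + 1)) {n : ℕ} (k : ℕ) (b' : Tor (Nsl N μ₀))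
  (φ : ZMod (N μ₀) → ℝ) (c : ℂ) {Ω : Tor N → Prop} [DecidablePred Ω] (z : Tor N → ℂ) (σ : Fin d → Bool)

/-- **WIDMAN'S HOLE-FILLING STEP ON A TUBE** (transversal dimension `d ≥ 2`, one longitudinal direction `μ₀`).  See the module docstring for the
notation; the conclusion is `E_in ≤ θ_d·E_out + 16(1+2^d)k²·(M/‖c‖⁴ + 4ℓ²·U)`. [folklore] -/
theorem tube_step (hd : 2 ≤ d) (hk : 2 ≤ k) (hn : 4 * k = n + 1) (hN' : ∀ ν, n + 1 ≤ Nsl N μ₀ ν) (hc : c ≠ 0)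
    (hz : ∀ x, ¬ Ω x → z x = 0) (hφ0 : ∀ t, 0 ≤ φ t) {ℓ : ℝ} (hφL : ∀ t, |φ (t + 1) - φ t| ≤ ℓ)
    (S : Finset (ZMod (N μ₀))) (hS1 : ∀ t, φ t ≠ 0 → t ∈ S) (hS2 : ∀ t, φ (t + 1) ≠ φ t → t ∈ S ∧ t + 1 ∈ S)
    (hvan : ∀ t ∈ S, ∀ j ∈ oct (n := n) k σ, zsl N μ₀ z t (chart (Nsl N μ₀) b' j) = 0) :
    ∑ t : ZMod (N μ₀), φ t ^ 2 * dirOn (inner (n := n) k) (zsl N μ₀ z t ∘ chart (Nsl N μ₀) (n := n) b')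
      ≤ theta d * ∑ t : ZMod (N μ₀), φ t ^ 2 * dirOn univ (zsl N μ₀ z t ∘ chart (Nsl N μ₀) (n := n) b')
        + 16 * (1 + 2 ^ d) * (k : ℝ) ^ 2 *
          ((∑ t : ZMod (N μ₀), φ t ^ 2 * ∑ j : Fin d → Fin (n + 1), ‖restrictTo Ω (LapS N c *ᵥ z) (ins N μ₀ t (chart (Nsl N μ₀) b' j))‖ ^ 2) / ‖c‖ ^ 4
            + 4 * ℓ ^ 2 * ∑ t ∈ S, dirOn univ (zsl N μ₀ z t ∘ chart (Nsl N μ₀) (n := n) b')) := by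
  -- the zone of longitudinal bonds where `φ` changes
  set T : Finset (ZMod (N μ₀)) := S.filter (fun t => φ (t + 1) ≠ φ t) with hTdef
  have hT' : ∀ t, φ (t + 1) ≠ φ t → t ∈ T := fun t h => by rw [hTdef, mem_filter]; exact ⟨(hS2 t h).1, h⟩
  have hTS : ∀ t ∈ T, t ∈ S ∧ t + 1 ∈ S := fun t ht => by rw [hTdef, mem_filter] at ht; exact hS2 t ht.2
  -- Caccioppoli with the tube cutoff and the three slice-wise budgets
  have hcac := caccioppoli_region N c (η := etaT N μ₀ (n := n) k b' φ) (etaT_nonneg N μ₀ k b' φ hk hn hφ0) hz (Ω := Ω)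
  have hL := lower_bound_tube N μ₀ k b' φ c z hk hn hN'
  have hE := error_bound_tube N μ₀ k b' φ z hk hn hN' hφL T hT'
  have hSrc := source_bound_tube N μ₀ k b' φ c z hk hn hN' (Ω := Ω)
  -- abbreviations
  set F : ZMod (N μ₀) → (Fin d → Fin (n + 1)) → ℂ := fun t => zsl N μ₀ z t ∘ chart (Nsl N μ₀) (n := n) b' with hF
  set Mt : ZMod (N μ₀) → ℝ := fun t => ∑ j : Fin d → Fin (n + 1), ‖restrictTo Ω (LapS N c *ᵥ z) (ins N μ₀ t (chart (Nsl N μ₀) b' j))‖ ^ 2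
    with hMt
  set P := (n : ℝ) * (n + 1) / 2 with hP
  set EwIn := ∑ t : ZMod (N μ₀), φ t ^ 2 * dirOn (inner (n := n) k) (F t) with hEwIn
  set EwOut := ∑ t : ZMod (N μ₀), φ t ^ 2 * dirOn univ (F t) with hEwOut
  set Mw := ∑ t : ZMod (N μ₀), φ t ^ 2 * Mt t with hMw
  set U := ∑ t ∈ S, dirOn univ (F t) with hU
  set LH := ∑ ν : Fin (d + 1), ∑ x : Tor N, etaT N μ₀ (n := n) k b' φ (x + unitVec N ν) ^ 2 * ‖(sdiff N c ν *ᵥ z) x‖ ^ 2 with hLH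
  set ER := ∑ ν : Fin (d + 1), ∑ x : Tor N, (etaT N μ₀ (n := n) k b' φ (x + unitVec N ν) - etaT N μ₀ (n := n) k b' φ x) ^ 2
      * (7 / 2 * ‖z x‖ ^ 2 + 1 / 2 * ‖z (x + unitVec N ν)‖ ^ 2) with hER
  set SR := (star (cut N (fun y => etaT N μ₀ (n := n) k b' φ y ^ 2) z) ⬝ᵥ restrictTo Ω (LapS N c *ᵥ z)).re with hSR
  have hcpos : 0 < ‖c‖ := norm_pos_iff.mpr hc
  have hc2 : 0 < ‖c‖ ^ 2 := by positivity
  have hk2 : (2 : ℝ) ≤ k := by exact_mod_cast hk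
  have hk1 : (0 : ℝ) < (k : ℝ) - 1 := by linarith
  have hnk : (n : ℝ) + 1 = 4 * k := by
    have : ((4 * k : ℕ) : ℝ) = ((n + 1 : ℕ) : ℝ) := by rw [hn]
    push_cast at this; linarith
  have hPk : P ≤ 8 * (k : ℝ) ^ 2 := by rw [hP, show (n : ℝ) = 4 * k - 1 by linarith]; nlinarith
  have hP0 : 0 < P := by rw [hP, show (n : ℝ) = 4 * k - 1 by linarith]; nlinarith
  have hann0 : 0 ≤ annConst d := by unfold annConst; positivity
  have hK := Kd_nonneg d
  have hDJ0 : ∀ t, 0 ≤ dirOn univ (F t) := fun t => dirOn_nonneg _ _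
  have hDI0 : ∀ t, 0 ≤ dirOn (inner (n := n) k) (F t) := fun t => dirOn_nonneg _ _
  have hMt0 : ∀ t, 0 ≤ Mt t := fun t => Finset.sum_nonneg fun _ _ => sq_nonneg _
  have hvanF : ∀ t ∈ S, ∀ j ∈ oct (n := n) k σ, F t j = 0 := hvan
  have hA_of_mem : ∀ t ∈ S, ∑ j : Fin d → Fin (n + 1), ‖F t j‖ ^ 2 ≤ (1 + 2 ^ d) * P * dirOn univ (F t) :=
    fun t ht => sum_norm_sq_cube_le hn σ (F t) (hvanF t ht)
  have hU0 : 0 ≤ U := Finset.sum_nonneg fun t _ => hDJ0 t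
  have hEwIn0 : 0 ≤ EwIn := Finset.sum_nonneg fun t _ => mul_nonneg (sq_nonneg _) (hDI0 t)
  have hEwOut0 : 0 ≤ EwOut := Finset.sum_nonneg fun t _ => mul_nonneg (sq_nonneg _) (hDJ0 t)
  have hMw0 : 0 ≤ Mw := Finset.sum_nonneg fun t _ => mul_nonneg (sq_nonneg _) (hMt0 t)
  -- (E′) transversal: per slice, the annulus inequality and the bond count
  have hEt : ∀ t, φ t ^ 2 * (4 / ((k : ℝ) - 1) ^ 2 * ∑ j : Fin d,
        (∑ y ∈ lo (n := n) j k, ‖F t y‖ ^ 2 + ∑ y ∈ hi (n := n) j k, ‖F t y‖ ^ 2))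
      ≤ φ t ^ 2 * (Kd d * (dirOn univ (F t) - dirOn (inner (n := n) k) (F t))) := by
    intro t
    by_cases hφt : φ t = 0
    · rw [hφt]; simp
    refine mul_le_mul_of_nonneg_left ?_ (sq_nonneg _)
    have hA := annulus_mass_le k σ hd hn (F t) (hvanF t (hS1 t hφt))
    have hB := slabs_dir_le k hn (F t)
    have hratio : 4 / ((k : ℝ) - 1) ^ 2 * P ≤ 128 := by
      rw [div_mul_eq_mul_div, div_le_iff₀ (by positivity), hP, show (n : ℝ) = 4 * k - 1 by linarith]
      nlinarith [sq_nonneg ((k : ℝ) - 2)]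
    have hsd0 : 0 ≤ slabDir (n := n) k (F t) := slabDir_nonneg k (F t)
    calc 4 / ((k : ℝ) - 1) ^ 2 * ∑ j : Fin d, (∑ y ∈ lo (n := n) j k, ‖F t y‖ ^ 2 + ∑ y ∈ hi (n := n) j k, ‖F t y‖ ^ 2)
        ≤ 4 / ((k : ℝ) - 1) ^ 2 * (annConst d * P * slabDir (n := n) k (F t)) := mul_le_mul_of_nonneg_left hA (by positivity)
      _ = (4 / ((k : ℝ) - 1) ^ 2 * P) * (annConst d * slabDir (n := n) k (F t)) := by ring
      _ ≤ 128 * (annConst d * (d * (dirOn univ (F t) - dirOn (inner (n := n) k) (F t)))) :=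
          mul_le_mul hratio (mul_le_mul_of_nonneg_left hB hann0) (mul_nonneg hann0 hsd0) (by norm_num)
      _ = Kd d * (dirOn univ (F t) - dirOn (inner (n := n) k) (F t)) := by rw [Kd]; ring
  have hEtrans : ∑ t : ZMod (N μ₀), φ t ^ 2 * (4 / ((k : ℝ) - 1) ^ 2 * ∑ j : Fin d,
        (∑ y ∈ lo (n := n) j k, ‖F t y‖ ^ 2 + ∑ y ∈ hi (n := n) j k, ‖F t y‖ ^ 2)) ≤ Kd d * (EwOut - EwIn) := by
    refine (Finset.sum_le_sum fun t _ => hEt t).trans (le_of_eq ?_)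
    rw [hEwOut, hEwIn, ← Finset.sum_sub_distrib, Finset.mul_sum]
    refine Finset.sum_congr rfl fun t _ => ?_
    ring
  -- (E′) longitudinal: cube Poincaré on both ends of every zone bond
  have hElong : ℓ ^ 2 * ∑ t ∈ T, (7 / 2 * ∑ j : Fin d → Fin (n + 1), ‖zsl N μ₀ z t (chart (Nsl N μ₀) b' j)‖ ^ 2
        + 1 / 2 * ∑ j : Fin d → Fin (n + 1), ‖zsl N μ₀ z (t + 1) (chart (Nsl N μ₀) b' j)‖ ^ 2)
      ≤ 4 * ℓ ^ 2 * ((1 + 2 ^ d) * P) * U := by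
    have h1 : ∑ t ∈ T, (7 / 2 * ∑ j : Fin d → Fin (n + 1), ‖zsl N μ₀ z t (chart (Nsl N μ₀) b' j)‖ ^ 2
          + 1 / 2 * ∑ j : Fin d → Fin (n + 1), ‖zsl N μ₀ z (t + 1) (chart (Nsl N μ₀) b' j)‖ ^ 2)
        ≤ ∑ t ∈ T, (7 / 2 * ((1 + 2 ^ d) * P * dirOn univ (F t)) + 1 / 2 * ((1 + 2 ^ d) * P * dirOn univ (F (t + 1)))) := by
      refine Finset.sum_le_sum fun t ht => ?_
      have h := hTS t ht
      exact add_le_add (mul_le_mul_of_nonneg_left (hA_of_mem t h.1) (by norm_num))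
        (mul_le_mul_of_nonneg_left (hA_of_mem (t + 1) h.2) (by norm_num))
    have hTsub : T ⊆ S := Finset.filter_subset _ _
    have h2 : ∑ t ∈ T, dirOn univ (F t) ≤ U := Finset.sum_le_sum_of_subset_of_nonneg hTsub fun t _ _ => hDJ0 t
    have h3 : ∑ t ∈ T, dirOn univ (F (t + 1)) ≤ U := by
      have hinj : ∀ a ∈ T, ∀ a' ∈ T, a + 1 = a' + 1 → a = a' := fun a _ a' _ h => add_right_cancel h
      rw [← Finset.sum_image (f := fun s => dirOn univ (F s)) hinj]
      refine Finset.sum_le_sum_of_subset_of_nonneg ?_ fun t _ _ => hDJ0 t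
      intro s hs
      rw [mem_image] at hs
      obtain ⟨t, ht, rfl⟩ := hs
      exact (hTS t ht).2
    have hsum : ∑ t ∈ T, (7 / 2 * ((1 + 2 ^ d) * P * dirOn univ (F t)) + 1 / 2 * ((1 + 2 ^ d) * P * dirOn univ (F (t + 1))))
        = (7 / 2 * ((1 + 2 ^ d) * P)) * ∑ t ∈ T, dirOn univ (F t) + (1 / 2 * ((1 + 2 ^ d) * P)) * ∑ t ∈ T, dirOn univ (F (t + 1)) := by
      rw [Finset.mul_sum, Finset.mul_sum, ← Finset.sum_add_distrib]
      exact Finset.sum_congr rfl fun t _ => by ring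
    have hCP : 0 ≤ (1 + 2 ^ d) * P := mul_nonneg (by positivity) hP0.le
    calc ℓ ^ 2 * ∑ t ∈ T, (7 / 2 * ∑ j : Fin d → Fin (n + 1), ‖zsl N μ₀ z t (chart (Nsl N μ₀) b' j)‖ ^ 2
          + 1 / 2 * ∑ j : Fin d → Fin (n + 1), ‖zsl N μ₀ z (t + 1) (chart (Nsl N μ₀) b' j)‖ ^ 2)
        ≤ ℓ ^ 2 * ((7 / 2 * ((1 + 2 ^ d) * P)) * ∑ t ∈ T, dirOn univ (F t)
            + (1 / 2 * ((1 + 2 ^ d) * P)) * ∑ t ∈ T, dirOn univ (F (t + 1))) := by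
          rw [← hsum]; exact mul_le_mul_of_nonneg_left h1 (sq_nonneg _)
      _ ≤ ℓ ^ 2 * ((7 / 2 * ((1 + 2 ^ d) * P)) * U + (1 / 2 * ((1 + 2 ^ d) * P)) * U) := by
          refine mul_le_mul_of_nonneg_left (add_le_add (mul_le_mul_of_nonneg_left h2 (by positivity))
            (mul_le_mul_of_nonneg_left h3 (by positivity))) (sq_nonneg _)
      _ = 4 * ℓ ^ 2 * ((1 + 2 ^ d) * P) * U := by ring
  have hE' : ER ≤ Kd d * (EwOut - EwIn) + 4 * ℓ ^ 2 * ((1 + 2 ^ d) * P) * U := by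
    refine hE.trans ?_
    exact add_le_add hEtrans hElong
  -- (S′): per slice, cube Poincaré + Cauchy–Schwarz + Young
  have hSt : ∀ t, φ t ^ 2 * (Real.sqrt (∑ j : Fin d → Fin (n + 1), ‖zsl N μ₀ z t (chart (Nsl N μ₀) b' j)‖ ^ 2) * Real.sqrt (Mt t))
      ≤ φ t ^ 2 * (‖c‖ ^ 2 / 4 * dirOn univ (F t) + (1 + 2 ^ d) * P / ‖c‖ ^ 2 * Mt t) := by
    intro t
    by_cases hφt : φ t = 0
    · rw [hφt]; simp
    refine mul_le_mul_of_nonneg_left ?_ (sq_nonneg _)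
    have hcube := hA_of_mem t (hS1 t hφt)
    have h1 : Real.sqrt (∑ j : Fin d → Fin (n + 1), ‖zsl N μ₀ z t (chart (Nsl N μ₀) b' j)‖ ^ 2)
        ≤ Real.sqrt ((1 + 2 ^ d) * P * dirOn univ (F t)) := Real.sqrt_le_sqrt hcube
    refine (mul_le_mul_of_nonneg_right h1 (Real.sqrt_nonneg _)).trans ?_
    have h2 := sqrt_mul_sqrt_le (X := (1 + 2 ^ d) * P * dirOn univ (F t)) (M := Mt t) (t := ‖c‖ ^ 2 / (2 * (1 + 2 ^ d) * P))
      (mul_nonneg (mul_nonneg (by positivity) hP0.le) (hDJ0 t)) (hMt0 t) (div_pos hc2 (mul_pos (mul_pos two_pos (by positivity)) hP0))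
    refine h2.trans (le_of_eq ?_)
    field_simp
    ring
  have hS' : SR ≤ ‖c‖ ^ 2 / 4 * EwOut + (1 + 2 ^ d) * P / ‖c‖ ^ 2 * Mw := by
    refine hSrc.trans ((Finset.sum_le_sum fun t _ => hSt t).trans (le_of_eq ?_))
    rw [hEwOut, hMw, Finset.mul_sum, Finset.mul_sum, ← Finset.sum_add_distrib]
    refine Finset.sum_congr rfl fun t _ => ?_
    ring
  -- fill the hole
  have hE'' : ‖c‖ ^ 2 * ER ≤ ‖c‖ ^ 2 * (Kd d * (EwOut - EwIn) + 4 * ℓ ^ 2 * ((1 + 2 ^ d) * P) * U) :=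
    mul_le_mul_of_nonneg_left hE' hc2.le
  have key : ‖c‖ ^ 2 * EwIn * (1 / 2 + Kd d)
      ≤ ‖c‖ ^ 2 * ((1 / 4 + Kd d) * EwOut) + (1 + 2 ^ d) * P / ‖c‖ ^ 2 * Mw + ‖c‖ ^ 2 * (4 * ℓ ^ 2 * ((1 + 2 ^ d) * P) * U) := by
    linarith [hcac, hL, hE'', hS']
  have key2 : EwIn * (1 / 2 + Kd d) ≤ (1 / 4 + Kd d) * EwOut + (1 + 2 ^ d) * P / ‖c‖ ^ 4 * Mw + 4 * ℓ ^ 2 * ((1 + 2 ^ d) * P) * U := by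
    refine le_of_mul_le_mul_left ?_ hc2
    have e : ‖c‖ ^ 2 * ((1 / 4 + Kd d) * EwOut + (1 + 2 ^ d) * P / ‖c‖ ^ 4 * Mw + 4 * ℓ ^ 2 * ((1 + 2 ^ d) * P) * U)
        = ‖c‖ ^ 2 * ((1 / 4 + Kd d) * EwOut) + (1 + 2 ^ d) * P / ‖c‖ ^ 2 * Mw + ‖c‖ ^ 2 * (4 * ℓ ^ 2 * ((1 + 2 ^ d) * P) * U) := by
      field_simp
    rw [e, ← mul_assoc]; exact key
  have hhalf : (0 : ℝ) < 1 / 2 + Kd d := by linarith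
  have key3 : EwIn ≤ (1 / 4 + Kd d) / (1 / 2 + Kd d) * EwOut
      + ((1 + 2 ^ d) * P / ‖c‖ ^ 4 * Mw + 4 * ℓ ^ 2 * ((1 + 2 ^ d) * P) * U) / (1 / 2 + Kd d) := by
    rw [div_mul_eq_mul_div, ← add_div, le_div_iff₀ hhalf]; linarith [key2]
  have htheta : (1 / 4 + Kd d) / (1 / 2 + Kd d) = theta d := by
    rw [theta, div_eq_div_iff hhalf.ne' (ne_of_gt (by linarith))]; ring
  rw [htheta] at key3
  refine key3.trans (add_le_add le_rfl ?_)
  -- the coefficient: `P ≤ 8k²`, `1/(½ + K) ≤ 2`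
  rw [div_le_iff₀ hhalf]
  have hsrc0 : 0 ≤ Mw / ‖c‖ ^ 4 + 4 * ℓ ^ 2 * U := add_nonneg (div_nonneg hMw0 (by positivity)) (mul_nonneg (by positivity) hU0)
  have h16 : (1 + 2 ^ d) * P / ‖c‖ ^ 4 * Mw + 4 * ℓ ^ 2 * ((1 + 2 ^ d) * P) * U
      ≤ 16 * (1 + 2 ^ d) * (k : ℝ) ^ 2 * (Mw / ‖c‖ ^ 4 + 4 * ℓ ^ 2 * U) * (1 / 2) := by
    have e : (1 + 2 ^ d) * P / ‖c‖ ^ 4 * Mw + 4 * ℓ ^ 2 * ((1 + 2 ^ d) * P) * U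
        = (1 + 2 ^ d) * P * (Mw / ‖c‖ ^ 4 + 4 * ℓ ^ 2 * U) := by ring
    rw [e, show 16 * (1 + 2 ^ d) * (k : ℝ) ^ 2 * (Mw / ‖c‖ ^ 4 + 4 * ℓ ^ 2 * U) * (1 / 2)
      = (1 + 2 ^ d) * (8 * (k : ℝ) ^ 2) * (Mw / ‖c‖ ^ 4 + 4 * ℓ ^ 2 * U) by ring]
    exact mul_le_mul_of_nonneg_right (mul_le_mul_of_nonneg_left hPk (by positivity)) hsrc0
  have hcoef : 0 ≤ 16 * (1 + 2 ^ d) * (k : ℝ) ^ 2 * (Mw / ‖c‖ ^ 4 + 4 * ℓ ^ 2 * U) := mul_nonneg (by positivity) hsrc0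
  have h17 : 16 * (1 + 2 ^ d) * (k : ℝ) ^ 2 * (Mw / ‖c‖ ^ 4 + 4 * ℓ ^ 2 * U) * (1 / 2)
      ≤ 16 * (1 + 2 ^ d) * (k : ℝ) ^ 2 * (Mw / ‖c‖ ^ 4 + 4 * ℓ ^ 2 * U) * (1 / 2 + Kd d) :=
    mul_le_mul_of_nonneg_left (by linarith) hcoef
  exact h16.trans h17

end Summit.QuantumFields.BalabanUV.T4Continuum.DirichletTubeHoleFilling

end
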